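import Mathlib
import HarnessLib
import Summits.Ventures.LatticeQCDFlow.Exactness.U1LeapfrogHMCErgodic
import Summits.Ventures.LatticeQCDFlow.Exactness.SU2LeapfrogFTHMCErgodic
import Summits.Ventures.LatticeQCDFlow.Exactness.U1WilsonFlowLOSubstep

/-!
# Field-transformed single-step leapfrog HMC on `U(1)` lattice gauge fields is uniformly ergodic; the engine's `U(1)` LO Wilson-flow sub-step is a pinched instance

HONEST FRAMING: exact (Metropolis-corrected) sampling algorithms for lattice gauge theory;
figures of merit are autocorrelation/cost numbers at stated couplings and volumes; no
continuum-physics claim.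

Venture `LatticeQCDFlow` (cell pub-lqcd), topic `Exactness`; FANOUT row 14 (`eng-flowhmc`, engine
`latflow.fthmc`, family B; the `U(1)` rung — member `maps.u1_wilson_flow_lo`, twin `ref_u1` — is
where the engine's chains of record ran).  NEW WORK of the cell; nothing is cited as a fact; no
number.  The `U(1)` twin of row 9's `SU2LeapfrogFTHMCErgodic.lean` (which did `SU(2)` only), over
row 9's `U1LeapfrogHMCErgodic.u1LeapfrogHMC_minorised` (Doeblin for single-step leapfrog HMC on
`U(1)^ι`, any bounded measurable action and momentum increment) and row 7's
`conjKernel_minorised`: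

* `abs_pulledBackAction_le` — `|S(F v) − log J(v)| ≤ s + |log j₁| + |log j₂|` for `|S| ≤ s`,
  `0 < j₁ ≤ J ≤ j₂` (any space);
* `u1LeapfrogFTHMC_invariant`, `u1LeapfrogFTHMC_invariant_gibbsLaw` — the REPORTED kernel
  `F ∘ K_(S∘F − log J) ∘ F⁻¹` leaves `e^(−S)·Haar^(⊗ι)` (and `π_S`) invariant for every measurable
  equivalence `F` of `U(1)^ι` with `HasJacobian Haar^(⊗ι) F J`, `J > 0` measurable
  (`thmc_config_exact`);
* **`u1LeapfrogFTHMC_uniformlyErgodic`**, **`u1LeapfrogFTHMC_invariant_unique`** — if moreover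
  `0 < j₁ ≤ J ≤ j₂` and `|S| ≤ s`, `‖g‖ ≤ b`, `ε, κ > 0`: `|μ₀ K̃ᵗ(A) − π_S(A)| ≤ (1 − δ)ᵗ` for some
  `δ ∈ (0, 1]`, every initial law, `t`, `A`; `π_S` is the unique invariant probability law;
* `abs_u1WilsonFlowLOFactorSum_le` (`|Σ_(ν ≠ μ) (Re P + Re P')| ≤ 2(d−1)`),
  **`u1WilsonFlowLOJacobian_mem_Icc`** — the booked density `∏_active (1 − εC)` of the engine's
  masked `U(1)` Wilson-flow sub-step (VERBATIM as certified in `U1WilsonFlowLOSubstep.lean`) is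
  PINCHED in `[(1 − κ₀)^n, (1 + κ₀)^n]`, `κ₀ = 2(d−1)|ε|`, `n` = number of active links;
* **`u1WilsonFlowLOSubstep_fthmc_uniformlyErgodic`** — hence FT-HMC (row 9's single-step kernel)
  through the engine's `U(1)` LO sub-step `(μ, b)` (proper colouring, `2(d−1)|ε| < 1`) is
  uniformly ergodic.

NOT CLAIMED: multi-step trajectories / OMF words; whole schedules on the `U(1)` rung (the product
argument of `SU2MaskedKickScheduleErgodic.foldr_logDet_mem_Icc` applies verbatim; not restated);
the learned `U(1)` members; any usable `δ`; floating point; any number.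
-/

noncomputable section

namespace Summit.Ventures.LatticeQCDFlow.Exactness

open MeasureTheory ProbabilityTheory ProbabilityTheory.Kernel Set
open Literature.MathematicalPhysics.QuantumFieldTheory
open scoped ENNReal

/-! ## The pulled-back action is bounded -/

section Action

variable {Ω : Type*}

/-- `|S(F v) − log J(v)| ≤ s + (|log j₁| + |log j₂|)` when `|S| ≤ s` and `0 < j₁ ≤ J ≤ j₂`. -/
theorem abs_pulledBackAction_le {S : Ω → ℝ} {s : ℝ} (hs : ∀ u, |S u| ≤ s) {F : Ω → Ω} {J : Ω → ℝ}
    {j₁ j₂ : ℝ} (hj₁ : 0 < j₁) (hJ₁ : ∀ v, j₁ ≤ J v) (hJ₂ : ∀ v, J v ≤ j₂) (v : Ω) :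
    |S (F v) - Real.log (J v)| ≤ s + (|Real.log j₁| + |Real.log j₂|) := by
  have hJpos : 0 < J v := hj₁.trans_le (hJ₁ v)
  have hlo : Real.log j₁ ≤ Real.log (J v) := Real.log_le_log hj₁ (hJ₁ v)
  have hhi : Real.log (J v) ≤ Real.log j₂ := Real.log_le_log hJpos (hJ₂ v)
  have hlog : |Real.log (J v)| ≤ |Real.log j₁| + |Real.log j₂| := by
    rcases le_or_gt 0 (Real.log (J v)) with h | h
    · rw [abs_of_nonneg h]
      exact (hhi.trans (le_abs_self _)).trans (le_add_of_nonneg_left (abs_nonneg _))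
    · rw [abs_of_neg h]
      exact ((neg_le_neg hlo).trans (neg_le_abs _)).trans (le_add_of_nonneg_right (abs_nonneg _))
  calc |S (F v) - Real.log (J v)| ≤ |S (F v)| + |Real.log (J v)| := abs_sub _ _
    _ ≤ s + (|Real.log j₁| + |Real.log j₂|) := add_le_add (hs _) hlog

end Action

/-! ## FT-HMC on `U(1)^ι`: exact, and uniformly ergodic for pinched Jacobians -/

section FTHMC

variable {ι : Type*} [Fintype ι] {ε κ : ℝ} {g : (ι → Circle) → ι → ℝ}
  {S : (ι → Circle) → ℝ} {s : ℝ} {F : (ι → Circle) ≃ᵐ (ι → Circle)} {J : (ι → Circle) → ℝ} {j₁ j₂ : ℝ}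

/-- **The reported `U(1)` FT-HMC kernel is exact**: single-step leapfrog HMC for `S∘F − log J`,
reported through `F`, leaves `e^(−S)·Haar^(⊗ι)` invariant (`thmc_config_exact`). -/
theorem u1LeapfrogFTHMC_invariant (hκ : 0 < κ) (hg : Measurable g) (hJ : ∀ v, 0 < J v)
    (hJm : Measurable J)
    (hF : HasJacobian (Measure.pi fun _ : ι => haarProbability Circle) F fun v => ENNReal.ofReal (J v))
    (hS : Measurable S) :
    Invariant (conjKernel (u1LeapfrogHMC ε κ hg fun v => S (F v) - Real.log (J v)) F)
      ((Measure.pi fun _ : ι => haarProbability Circle).withDensity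
        fun u => ENNReal.ofReal (Real.exp (-S u))) :=
  thmc_config_exact (vol := Measure.pi fun _ : ι => haarProbability Circle)
    (volP := volume) (hΦ := measurable_u1LeapfrogProposal ε hg) hJ hJm hF hS (measurable_u1Kinetic κ)
    (involutive_u1LeapfrogProposal ε) (measurePreserving_u1LeapfrogProposal ε hg)
    (u1MomentumWeight_univ_ne_zero hκ) (u1MomentumWeight_univ_ne_top hκ)

/-- … and the normalised Gibbs law `π_S` is invariant. -/
theorem u1LeapfrogFTHMC_invariant_gibbsLaw (hκ : 0 < κ) (hg : Measurable g) (hJ : ∀ v, 0 < J v)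
    (hJm : Measurable J)
    (hF : HasJacobian (Measure.pi fun _ : ι => haarProbability Circle) F fun v => ENNReal.ofReal (J v))
    (hS : Measurable S) :
    Invariant (conjKernel (u1LeapfrogHMC ε κ hg fun v => S (F v) - Real.log (J v)) F) (u1GibbsLaw S) :=
  invariant_smul (u1LeapfrogFTHMC_invariant hκ hg hJ hJm hF hS) _

/-- **FIELD-TRANSFORMED SINGLE-STEP LEAPFROG HMC ON `U(1)^ι` IS UNIFORMLY ERGODIC** for every
measurable equivalence `F` with a PINCHED certified Jacobian `0 < j₁ ≤ J ≤ j₂`, every measurable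
`|S| ≤ s`, momentum increment `‖g‖ ≤ b`, `ε, κ > 0`. -/
theorem u1LeapfrogFTHMC_uniformlyErgodic (hε : 0 < ε) (hκ : 0 < κ) (hg : Measurable g) {b : ℝ}
    (hb0 : 0 ≤ b) (hb : ∀ u l, ‖g u l‖ ≤ b) (hS : Measurable S) (hs : ∀ u, |S u| ≤ s)
    (hj₁ : 0 < j₁) (hJ₁ : ∀ v, j₁ ≤ J v) (hJ₂ : ∀ v, J v ≤ j₂) (hJm : Measurable J)
    (hF : HasJacobian (Measure.pi fun _ : ι => haarProbability Circle) F fun v => ENNReal.ofReal (J v)) :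
    ∃ δ : ℝ, 0 < δ ∧ δ ≤ 1 ∧ ∀ (μ₀ : Measure (ι → Circle)) [IsProbabilityMeasure μ₀] (t : ℕ) (A : Set (ι → Circle)),
      |((fun m : Measure (ι → Circle) =>
            m.bind (conjKernel (u1LeapfrogHMC ε κ hg fun v => S (F v) - Real.log (J v)) F))^[t] μ₀).real A
          - (u1GibbsLaw S).real A| ≤ (1 - δ) ^ t := by
  haveI : Fact (0 < κ) := ⟨hκ⟩
  haveI := isProbabilityMeasure_u1GibbsLaw (ι := ι) hs
  have hJ : ∀ v, 0 < J v := fun v => hj₁.trans_le (hJ₁ v)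
  have hSt : Measurable fun v : ι → Circle => S (F v) - Real.log (J v) :=
    (hS.comp F.measurable).sub (Real.measurable_log.comp hJm)
  obtain ⟨δ, hδ0, hmin⟩ := u1LeapfrogHMC_minorised hε hκ hg hb0 hb hSt
    (abs_pulledBackAction_le hs hj₁ hJ₁ hJ₂)
  have hmin' := fun x => conjKernel_minorised hmin F x
  have hH : Measurable fun z : (ι → Circle) × (ι → ℝ) => (S (F z.1) - Real.log (J z.1)) + u1Kinetic κ z.2 :=
    (hSt.comp measurable_fst).add ((measurable_u1Kinetic κ).comp measurable_snd)
  haveI : Fact (Measurable fun z : (ι → Circle) × (ι → ℝ) => (S (F z.1) - Real.log (J z.1)) + u1Kinetic κ z.2) := ⟨hH⟩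
  haveI : IsMarkovKernel (u1LeapfrogHMC ε κ hg fun v => S (F v) - Real.log (J v)) := by
    unfold u1LeapfrogHMC; infer_instance
  haveI : IsProbabilityMeasure ((Measure.pi fun _ : ι => haarProbability Circle).map F) :=
    Measure.isProbabilityMeasure_map F.measurable.aemeasurable
  have hδ1 : δ ≤ 1 := by
    have h := Measure.le_iff'.1 (hmin fun _ => 1) univ
    rwa [Measure.smul_apply, smul_eq_mul, measure_univ, measure_univ, mul_one] at h
  have hδtop : δ ≠ ⊤ := ne_top_of_le_ne_top ENNReal.one_ne_top hδ1
  refine ⟨δ.toReal, ENNReal.toReal_pos hδ0.ne' hδtop,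
    ENNReal.toReal_le_of_le_ofReal zero_le_one (by rwa [ENNReal.ofReal_one]), fun μ₀ _ t A => ?_⟩
  exact uniformlyErgodic_of_minorised hmin' (u1LeapfrogFTHMC_invariant_gibbsLaw hκ hg hJ hJm hF hS) μ₀ t A

/-- **The Gibbs law is the unique invariant probability law of the reported `U(1)` FT-HMC kernel**
(same hypotheses). -/
theorem u1LeapfrogFTHMC_invariant_unique (hε : 0 < ε) (hκ : 0 < κ) (hg : Measurable g) {b : ℝ}
    (hb0 : 0 ≤ b) (hb : ∀ u l, ‖g u l‖ ≤ b) (hS : Measurable S) (hs : ∀ u, |S u| ≤ s)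
    (hj₁ : 0 < j₁) (hJ₁ : ∀ v, j₁ ≤ J v) (hJ₂ : ∀ v, J v ≤ j₂) (hJm : Measurable J)
    (hF : HasJacobian (Measure.pi fun _ : ι => haarProbability Circle) F fun v => ENNReal.ofReal (J v))
    {π' : Measure (ι → Circle)} [IsProbabilityMeasure π']
    (hπ' : Invariant (conjKernel (u1LeapfrogHMC ε κ hg fun v => S (F v) - Real.log (J v)) F) π') :
    π' = u1GibbsLaw S := by
  haveI : Fact (0 < κ) := ⟨hκ⟩
  haveI := isProbabilityMeasure_u1GibbsLaw (ι := ι) hs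
  have hJ : ∀ v, 0 < J v := fun v => hj₁.trans_le (hJ₁ v)
  have hSt : Measurable fun v : ι → Circle => S (F v) - Real.log (J v) :=
    (hS.comp F.measurable).sub (Real.measurable_log.comp hJm)
  obtain ⟨δ, hδ0, hmin⟩ := u1LeapfrogHMC_minorised hε hκ hg hb0 hb hSt
    (abs_pulledBackAction_le hs hj₁ hJ₁ hJ₂)
  have hmin' := fun x => conjKernel_minorised hmin F x
  haveI : Fact (Measurable fun z : (ι → Circle) × (ι → ℝ) => (S (F z.1) - Real.log (J z.1)) + u1Kinetic κ z.2) :=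
    ⟨(hSt.comp measurable_fst).add ((measurable_u1Kinetic κ).comp measurable_snd)⟩
  haveI : IsMarkovKernel (u1LeapfrogHMC ε κ hg fun v => S (F v) - Real.log (J v)) := by
    unfold u1LeapfrogHMC; infer_instance
  haveI : IsProbabilityMeasure ((Measure.pi fun _ : ι => haarProbability Circle).map F) :=
    Measure.isProbabilityMeasure_map F.measurable.aemeasurable
  exact invariant_unique_of_minorised hmin' hδ0 (u1LeapfrogFTHMC_invariant_gibbsLaw hκ hg hJ hJm hF hS) hπ'

end FTHMC

/-! ## The engine's `U(1)` LO sub-step: pinched density, uniform ergodicity -/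

section U1LO

variable {d L : ℕ} {X : Type*} [DecidableEq X] (χ : Site d L → X) [NeZero L]

omit [NeZero L] in
/-- `|Σ_(ν ≠ μ) (Re P(x,μ,ν) + Re P(x−ν̂,μ,ν))| ≤ 2(d−1)`: every plaquette holonomy is a unit complex
number. -/
theorem abs_u1WilsonFlowLOFactorSum_le (V : GaugeConfig d L Circle) (e : Edge d L) :
    |∑ ν ∈ Finset.univ.erase e.2,
        (((plaquetteHolonomy V e.1 e.2 ν : Circle) : ℂ).re +
          ((plaquetteHolonomy V (e.1 - Pi.single ν 1) e.2 ν : Circle) : ℂ).re)| ≤ 2 * ((d - 1 : ℕ) : ℝ) := by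
  have hcard : (((Finset.univ.erase e.2).card : ℕ) : ℝ) = ((d - 1 : ℕ) : ℝ) := by
    rw [Finset.card_erase_of_mem (Finset.mem_univ _), Finset.card_univ, Fintype.card_fin]
  have hre : ∀ z : Circle, |((z : Circle) : ℂ).re| ≤ 1 := fun z => by
    have h := Complex.abs_re_le_norm (z : ℂ)
    rwa [Circle.norm_coe] at h
  refine (Finset.abs_sum_le_sum_abs _ _).trans ?_
  have hterm : ∀ ν ∈ Finset.univ.erase e.2,
      |((plaquetteHolonomy V e.1 e.2 ν : Circle) : ℂ).re +
          ((plaquetteHolonomy V (e.1 - Pi.single ν 1) e.2 ν : Circle) : ℂ).re| ≤ 2 := by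
    intro ν _
    have h1 := hre (plaquetteHolonomy V e.1 e.2 ν)
    have h2 := hre (plaquetteHolonomy V (e.1 - Pi.single ν 1) e.2 ν)
    have h3 := abs_add_le ((plaquetteHolonomy V e.1 e.2 ν : Circle) : ℂ).re
      ((plaquetteHolonomy V (e.1 - Pi.single ν 1) e.2 ν : Circle) : ℂ).re
    linarith
  calc ∑ ν ∈ Finset.univ.erase e.2, |((plaquetteHolonomy V e.1 e.2 ν : Circle) : ℂ).re +
          ((plaquetteHolonomy V (e.1 - Pi.single ν 1) e.2 ν : Circle) : ℂ).re|
      ≤ ∑ _ν ∈ Finset.univ.erase e.2, (2 : ℝ) := Finset.sum_le_sum hterm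
    _ = 2 * ((d - 1 : ℕ) : ℝ) := by rw [Finset.sum_const, nsmul_eq_mul, hcard, mul_comm]

/-- **The booked density of the engine's `U(1)` LO sub-step is pinched**:
`(1 − κ₀)^n ≤ ∏_active (1 − ε C) ≤ (1 + κ₀)^n` with `κ₀ = 2(d−1)|ε| ≤ 1`, `n` = number of active
links. -/
theorem u1WilsonFlowLOJacobian_mem_Icc (μ : Fin d) (b : X) {ε : ℝ} (hε : |ε| * (2 * ((d - 1 : ℕ) : ℝ)) ≤ 1)
    (V : GaugeConfig d L Circle) :
    (∏ a : {e : Edge d L // e.2 = μ ∧ χ e.1 = b},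
          (1 - ε * ∑ ν ∈ Finset.univ.erase a.1.2,
            (((plaquetteHolonomy V a.1.1 a.1.2 ν : Circle) : ℂ).re +
              ((plaquetteHolonomy V (a.1.1 - Pi.single ν 1) a.1.2 ν : Circle) : ℂ).re))) ∈
      Icc ((1 - |ε| * (2 * ((d - 1 : ℕ) : ℝ))) ^ Fintype.card {e : Edge d L // e.2 = μ ∧ χ e.1 = b})
        ((1 + |ε| * (2 * ((d - 1 : ℕ) : ℝ))) ^ Fintype.card {e : Edge d L // e.2 = μ ∧ χ e.1 = b}) := by
  have hfac : ∀ a : {e : Edge d L // e.2 = μ ∧ χ e.1 = b},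
      (1 - ε * ∑ ν ∈ Finset.univ.erase a.1.2,
            (((plaquetteHolonomy V a.1.1 a.1.2 ν : Circle) : ℂ).re +
              ((plaquetteHolonomy V (a.1.1 - Pi.single ν 1) a.1.2 ν : Circle) : ℂ).re)) ∈
        Icc (1 - |ε| * (2 * ((d - 1 : ℕ) : ℝ))) (1 + |ε| * (2 * ((d - 1 : ℕ) : ℝ))) := by
    intro a
    have hC := abs_u1WilsonFlowLOFactorSum_le V a.1
    have hprod : |ε * ∑ ν ∈ Finset.univ.erase a.1.2,
            (((plaquetteHolonomy V a.1.1 a.1.2 ν : Circle) : ℂ).re +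
              ((plaquetteHolonomy V (a.1.1 - Pi.single ν 1) a.1.2 ν : Circle) : ℂ).re)| ≤
        |ε| * (2 * ((d - 1 : ℕ) : ℝ)) := by
      rw [abs_mul]
      exact mul_le_mul_of_nonneg_left hC (abs_nonneg ε)
    constructor
    · linarith [(abs_le.mp hprod).2]
    · linarith [(abs_le.mp hprod).1]
  have h0 : 0 ≤ 1 - |ε| * (2 * ((d - 1 : ℕ) : ℝ)) := by linarith
  constructor
  · calc (1 - |ε| * (2 * ((d - 1 : ℕ) : ℝ))) ^ Fintype.card {e : Edge d L // e.2 = μ ∧ χ e.1 = b}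
        = ∏ _a : {e : Edge d L // e.2 = μ ∧ χ e.1 = b}, (1 - |ε| * (2 * ((d - 1 : ℕ) : ℝ))) := by
          rw [Finset.prod_const, Finset.card_univ]
      _ ≤ _ := Finset.prod_le_prod (fun a _ => h0) fun a _ => (hfac a).1
  · calc (∏ a : {e : Edge d L // e.2 = μ ∧ χ e.1 = b},
          (1 - ε * ∑ ν ∈ Finset.univ.erase a.1.2,
            (((plaquetteHolonomy V a.1.1 a.1.2 ν : Circle) : ℂ).re +
              ((plaquetteHolonomy V (a.1.1 - Pi.single ν 1) a.1.2 ν : Circle) : ℂ).re)))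
        ≤ ∏ _a : {e : Edge d L // e.2 = μ ∧ χ e.1 = b}, (1 + |ε| * (2 * ((d - 1 : ℕ) : ℝ))) :=
          Finset.prod_le_prod (fun a _ => h0.trans (hfac a).1) fun a _ => (hfac a).2
      _ = (1 + |ε| * (2 * ((d - 1 : ℕ) : ℝ))) ^ Fintype.card {e : Edge d L // e.2 = μ ∧ χ e.1 = b} := by
          rw [Finset.prod_const, Finset.card_univ]

/-- **FT-HMC (row 9's single-step leapfrog kernel) through the engine's masked `U(1)` Wilson-flow
sub-step `(μ, b)` is uniformly ergodic** (proper colouring, `2(d−1)|ε| < 1`; any measurable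
`|S| ≤ s`, `‖g‖ ≤ b'`, `ε', κ' > 0`). -/
theorem u1WilsonFlowLOSubstep_fthmc_uniformlyErgodic
    (hχ : ∀ (x : Site d L) (i : Fin d), χ (x.shift i) ≠ χ x) (μ : Fin d) (b : X) {ε : ℝ}
    (hε : |ε| * (2 * ((d - 1 : ℕ) : ℝ)) < 1)
    {ε' κ' : ℝ} (hε' : 0 < ε') (hκ' : 0 < κ')
    {g : GaugeConfig d L Circle → Edge d L → ℝ} (hg : Measurable g) {b' : ℝ} (hb0 : 0 ≤ b')
    (hb : ∀ u l, ‖g u l‖ ≤ b') {S : GaugeConfig d L Circle → ℝ} (hS : Measurable S) {s' : ℝ} (hs : ∀ u, |S u| ≤ s') :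
    ∃ F : GaugeConfig d L Circle ≃ᵐ GaugeConfig d L Circle,
      (⇑F = fun (V : GaugeConfig d L Circle) (e : Edge d L) => if e.2 = μ ∧ χ e.1 = b then
          V e * Circle.exp (ε * ∑ ν ∈ Finset.univ.erase e.2,
            (((plaquetteHolonomy V (e.1 - Pi.single ν 1) e.2 ν : Circle) : ℂ).im -
              ((plaquetteHolonomy V e.1 e.2 ν : Circle) : ℂ).im)) else V e) ∧
      ∃ δ : ℝ, 0 < δ ∧ δ ≤ 1 ∧ ∀ (μ₀ : Measure (GaugeConfig d L Circle)) [IsProbabilityMeasure μ₀] (t : ℕ) (A : Set (GaugeConfig d L Circle)),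
        |((fun m : Measure (GaugeConfig d L Circle) =>
              m.bind (conjKernel (u1LeapfrogHMC ε' κ' hg fun V => S (F V) - Real.log (∏ a : {e : Edge d L // e.2 = μ ∧ χ e.1 = b},
          (1 - ε * ∑ ν ∈ Finset.univ.erase a.1.2,
            (((plaquetteHolonomy V a.1.1 a.1.2 ν : Circle) : ℂ).re +
              ((plaquetteHolonomy V (a.1.1 - Pi.single ν 1) a.1.2 ν : Circle) : ℂ).re)))) F))^[t] μ₀).real A
            - (u1GibbsLaw S).real A| ≤ (1 - δ) ^ t := by
  obtain ⟨F, hF, hJac, hpos, hmeas⟩ := exists_measurableEquiv_u1WilsonFlowLOSubstep χ hχ μ b hε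
  refine ⟨F, hF, ?_⟩
  have hpinch := fun V => u1WilsonFlowLOJacobian_mem_Icc χ μ b hε.le V
  exact u1LeapfrogFTHMC_uniformlyErgodic hε' hκ' hg hb0 hb hS hs
    (pow_pos (by linarith) _) (fun v => (hpinch v).1) (fun v => (hpinch v).2) hmeas hJac

end U1LO

end Summit.Ventures.LatticeQCDFlow.Exactness
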